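import Mathlib
import Summits.Ventures.PercRepro.TriangleCapResidueStrict

/-!
# PercRepro — ONE BELOW THE THRESHOLD: THE ARITHMETIC (p3, gen 56; part 325)

Two inequalities behind the exact bottom one below the threshold in the wide regime `D ≥ 4 r − 2` (part 326).
(1) `residue_one_below`: for `2 ≤ r = t mod D`, `4 r ≤ D + 2`, `I ≤ t`, `I ≠ r`:
`2 r (D − r) ≤ 2 I + φ_D(t + I) + φ_D(t − I) + 2 (r − 1)(r − 2)` — i.e. off `I = r` the abstract residue value is at
least `g(r − 1) = 2 r (D − r) − 2 (r − 1)(r − 2)` (`I < r`: `I (I − 1) ≤ (r − 1)(r − 2)`; `r < I < D − r`: the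
factorisation `I (D + 1 − I) − (r + 1)(D − r) = (I − r − 1)(D − r − I) ≥ 0` and `D ≥ 4 r − 2`; `I ≥ D − r ≥ 3 r − 2`:
subadditivity).  (2) `column_loss`: values `c ≤ D` with `Σ c ≡ 2 r (mod D)` and two distinguished members
`1 ≤ c(x), c(x')` with `c(x) + c(x') ≤ D + 2 r − 1` have `Σ c (D − c) ≥ φ_D(2 r) + 4 r − 2` (one of them full: the
other `v ≤ 2 r − 1` and the rest `≡ 2 r − v`, surplus `2 v (2 r − v) ≥ 4 r − 2`; both partial with `v + v' ≤ 2 r`: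
surplus `2 (v + v' − 1)(2 r − v − v')`; both partial with `v + v' > 2 r`: the rest `≡ D + 2 r − v − v'`, the
surplus `2 D − 4 r` at the ends of the range by concavity).  Axioms: standard.
-/

namespace PercRepro

namespace TriangleCap

namespace C047

open Finset

/-- **THE ABSTRACT RESIDUE VALUE ONE BELOW THE THRESHOLD:** for `2 ≤ r = t mod D`, `4 r ≤ D + 2`, `I ≤ t`, `I ≠ r`,
`2 r (D − r) ≤ 2 I + φ_D(t + I) + φ_D(t − I) + 2 (r − 1)(r − 2)`. -/
theorem residue_one_below (D t I : ℕ) (hD : 0 < D) (hI : I ≤ t) (hr : 2 ≤ t % D) (h4 : 4 * (t % D) ≤ D + 2)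
    (hIr : I ≠ t % D) :
    2 * ((t % D) * (D - t % D)) ≤
      2 * I + phiD D (t + I) + phiD D (t - I) + 2 * ((t % D - 1) * (t % D - 2)) := by
  obtain ⟨r, hr'⟩ : ∃ r, t % D = r := ⟨_, rfl⟩
  rw [hr'] at hr h4 hIr ⊢
  have hrD : r < D := by omega
  have h2r : 2 * r ≤ D := by omega
  rcases Nat.eq_zero_or_pos I with rfl | hI1
  · simp only [add_zero, Nat.sub_zero, mul_zero, zero_add]
    rw [phiD_mod D t, hr', phiD_of_lt D r hrD]
    omega
  rcases Nat.lt_or_ge I r with hIlt | hIge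
  · -- `1 ≤ I < r`
    have h1 : phiD D (t + I) = (r + I) * (D - r - I) := by
      rw [phiD_mod, Nat.add_mod, hr', Nat.mod_eq_of_lt (show I < D by omega),
        Nat.mod_eq_of_lt (show r + I < D by omega), phiD_of_lt D _ (by omega), Nat.sub_sub]
    have h2 : phiD D (t - I) = (r - I) * (D - r + I) := by
      have ht : t - I = D * (t / D) + (r - I) := by
        have := Nat.div_add_mod t D
        omega
      rw [phiD_mod, ht, Nat.mul_add_mod, Nat.mod_eq_of_lt (by omega : r - I < D), phiD_of_lt D _ (by omega)]
      congr 1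
      omega
    rw [h1, h2]
    have hpr : I * (I - 1) ≤ (r - 1) * (r - 2) := Nat.mul_le_mul (by omega) (by omega)
    zify [hIlt.le, (by omega : r ≤ D), (by omega : r + I ≤ D), (by omega : 1 ≤ r), (by omega : 2 ≤ r),
      (by omega : 1 ≤ I), (by omega : I ≤ D - r)] at hpr ⊢
    nlinarith [hpr]
  · rcases Nat.lt_or_ge (r + I) D with hlt | hge
    · -- `r < I < D − r`: no wrap
      have h1 : phiD D (t + I) = (r + I) * (D - r - I) := by
        rw [phiD_mod, Nat.add_mod, hr', Nat.mod_eq_of_lt (show I < D by omega),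
          Nat.mod_eq_of_lt (show r + I < D by omega), phiD_of_lt D _ (by omega), Nat.sub_sub]
      have h2 : phiD D (t - I) = (D + r - I) * (I - r) := by
        have hq1 : 1 ≤ t / D := by
          by_contra hcon
          have h0 : t / D = 0 := Nat.lt_one_iff.mp (Nat.lt_of_not_le hcon)
          have := Nat.div_add_mod t D
          rw [h0, mul_zero, zero_add, hr'] at this
          omega
        obtain ⟨q, hq⟩ : ∃ q, t / D = q + 1 := ⟨t / D - 1, by omega⟩
        have ht : t - I = D * q + (D + r - I) := by
          have := Nat.div_add_mod t D
          rw [hq, Nat.mul_succ, hr'] at this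
          omega
        rw [phiD_mod, ht, Nat.mul_add_mod, Nat.mod_eq_of_lt (by omega : D + r - I < D),
          phiD_of_lt D _ (by omega)]
        congr 1
        omega
      rw [h1, h2]
      have hk : 0 ≤ ((I : ℤ) - r - 1) * ((D : ℤ) - r - I) := by
        apply mul_nonneg <;> omega
      zify [(by omega : r ≤ D), (by omega : r + I ≤ D), (by omega : r ≤ I), (by omega : 1 ≤ r), (by omega : 2 ≤ r),
        (by omega : I ≤ D + r), (by omega : I ≤ D - r)] at hk h4 ⊢
      nlinarith [hk, h4]
    · -- `I ≥ D − r ≥ 3 r − 2`: subadditivity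
      have hsub : phiD D (2 * t) ≤ phiD D (t + I) + phiD D (t - I) := by
        have := phiD_add_le D (t + I) (t - I)
        have e : t + I + (t - I) = 2 * t := by omega
        rw [e] at this
        exact this
      rw [phiD_two_mul_mod, hr', phiD_two_mul_of_le D r h2r] at hsub
      have hI3 : 3 * r ≤ I + 2 := by omega
      have key : 2 * (r * (D - r)) ≤ 2 * I + 2 * r * (D - 2 * r) + 2 * ((r - 1) * (r - 2)) := by
        obtain ⟨u, rfl⟩ : ∃ u, D = 2 * r + u := ⟨D - 2 * r, by omega⟩
        obtain ⟨r', rfl⟩ : ∃ r', r = r' + 2 := ⟨r - 2, by omega⟩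
        have e1 : 2 * (r' + 2) + u - (r' + 2) = r' + 2 + u := by omega
        have e2 : 2 * (r' + 2) + u - 2 * (r' + 2) = u := by omega
        have e3 : r' + 2 - 1 = r' + 1 := by omega
        have e4 : r' + 2 - 2 = r' := by omega
        rw [e1, e2, e3, e4]
        nlinarith
      omega

/-- A partial value costs at least `D − 1`: `1 ≤ c ≤ D − 1` gives `D − 1 ≤ c (D − c)`. -/
theorem partial_cost (D c : ℕ) (h1 : 1 ≤ c) (h2 : c + 1 ≤ D) : D - 1 ≤ c * (D - c) := by
  obtain ⟨c', rfl⟩ : ∃ c', c = c' + 1 := ⟨c - 1, by omega⟩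
  obtain ⟨d', hd'⟩ : ∃ d', D = c' + 1 + (d' + 1) := ⟨D - c' - 2, by omega⟩
  subst hd'
  have e1 : c' + 1 + (d' + 1) - 1 = c' + d' + 1 := by omega
  have e2 : c' + 1 + (d' + 1) - (c' + 1) = d' + 1 := by omega
  rw [e1, e2]
  nlinarith

/-- The residue of `x < 3 D` modulo `D`. -/
theorem mod_three_cases (x D : ℕ) (hx : x < 3 * D) :
    (x < D ∧ x % D = x) ∨ (D ≤ x ∧ x < 2 * D ∧ x % D = x - D) ∨ (2 * D ≤ x ∧ x % D = x - 2 * D) := by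
  rcases Nat.lt_or_ge x D with h1 | h1
  · exact Or.inl ⟨h1, Nat.mod_eq_of_lt h1⟩
  rcases Nat.lt_or_ge x (2 * D) with h2 | h2
  · refine Or.inr (Or.inl ⟨h1, h2, ?_⟩)
    rw [Nat.mod_eq_sub_mod h1, Nat.mod_eq_of_lt (by omega)]
  · refine Or.inr (Or.inr ⟨h2, ?_⟩)
    rw [Nat.mod_eq_sub_mod h1, Nat.mod_eq_sub_mod (by omega : D ≤ x - D), Nat.mod_eq_of_lt (by omega)]
    omega

/-- One end full: `v' ≤ 2 r − 1` and the rest `≡ 2 r − v'`; the surplus is `2 (v' − 1)(2 r − 1 − v')`. -/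
theorem column_loss_full (D r v' : ℕ) (h2r : 2 * r ≤ D) (hv' : 1 ≤ v') (hv2 : v' + 1 ≤ 2 * r) :
    2 * r * (D - 2 * r) + (4 * r - 2) ≤ v' * (D - v') + (2 * r - v') * (D - (2 * r - v')) := by
  obtain ⟨u, rfl⟩ : ∃ u, D = 2 * r + u := ⟨D - 2 * r, by omega⟩
  obtain ⟨a, rfl⟩ : ∃ a, v' = a + 1 := ⟨v' - 1, by omega⟩
  obtain ⟨c, hc⟩ : ∃ c, 2 * r = a + c + 2 := ⟨2 * r - a - 2, by omega⟩
  have e0 : 4 * r - 2 = 2 * (a + c) + 2 := by omega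
  rw [e0, hc]
  have e1 : a + c + 2 + u - (a + c + 2) = u := by omega
  have e2 : a + c + 2 + u - (a + 1) = c + 1 + u := by omega
  have e3 : a + c + 2 - (a + 1) = c + 1 := by omega
  have e4 : a + c + 2 + u - (c + 1) = a + 1 + u := by omega
  rw [e1, e2, e3, e4]
  nlinarith [Nat.zero_le (a * c)]

/-- Both ends partial with `v + v' ≤ 2 r`: the rest `≡ 2 r − v − v'`; the surplus is
`2 (v − 1)(v' − 1) + 2 (v + v' − 1)(2 r − v − v')`. -/
theorem column_loss_low (D r v v' : ℕ) (h2r : 2 * r ≤ D) (hv : 1 ≤ v) (hv' : 1 ≤ v') (hs : v + v' ≤ 2 * r) :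
    2 * r * (D - 2 * r) + (4 * r - 2) ≤
      v * (D - v) + v' * (D - v') + (2 * r - (v + v')) * (D - (2 * r - (v + v'))) := by
  obtain ⟨u, rfl⟩ : ∃ u, D = 2 * r + u := ⟨D - 2 * r, by omega⟩
  obtain ⟨a, rfl⟩ : ∃ a, v = a + 1 := ⟨v - 1, by omega⟩
  obtain ⟨b, rfl⟩ : ∃ b, v' = b + 1 := ⟨v' - 1, by omega⟩
  obtain ⟨c, hc⟩ : ∃ c, 2 * r = a + b + 2 + c := ⟨2 * r - a - b - 2, by omega⟩
  have e0 : 4 * r - 2 = 2 * (a + b + c) + 2 := by omega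
  rw [e0, hc]
  have e1 : a + b + 2 + c + u - (a + b + 2 + c) = u := by omega
  have e2 : a + b + 2 + c + u - (a + 1) = b + c + 1 + u := by omega
  have e3 : a + b + 2 + c + u - (b + 1) = a + c + 1 + u := by omega
  have e4 : a + b + 2 + c - (a + 1 + (b + 1)) = c := by omega
  have e5 : a + b + 2 + c + u - c = a + b + 2 + u := by omega
  rw [e1, e2, e3, e4, e5]
  nlinarith [Nat.zero_le (a * b), Nat.zero_le (c * (a + b + 1))]

/-- Both ends partial with `v + v' > 2 r`, in the variables `a = D − v`, `a' = D − v'`: the rest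
`≡ a + a' + 2 r − D`; the surplus is at least `2 D − 4 r` (concavity in `a + a'`). -/
theorem column_loss_high (D r a a' : ℕ) (hr : 1 ≤ r) (h2r : 2 * r ≤ D) (ha : 1 ≤ a) (haD : a + 1 ≤ D)
    (ha' : 1 ≤ a') (ha'D : a' + 1 ≤ D) (hs1 : D + 1 ≤ a + a' + 2 * r) (hs2 : a + a' + 2 * r + 1 ≤ 2 * D) :
    2 * r * (D - 2 * r) + (4 * r - 2) ≤
      (D - a) * a + (D - a') * a' + (a + a' + 2 * r - D) * (2 * D - 2 * r - (a + a')) := by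
  rcases Nat.lt_or_ge (a + a') (D + 1) with hu | hu
  · have hk1 : 0 ≤ ((a : ℤ) - 1) * ((a' : ℤ) - 1) := by
      apply mul_nonneg <;> omega
    have hk2 : 0 ≤ ((a : ℤ) + a' + 2 * r - D - 1) * ((D : ℤ) - (a + a')) := by
      apply mul_nonneg <;> omega
    zify [(by omega : a ≤ D), (by omega : a' ≤ D), (by omega : D ≤ a + a' + 2 * r), (by omega : 2 * r ≤ D),
      (by omega : 2 ≤ 4 * r), (by omega : a + a' ≤ 2 * D - 2 * r), (by omega : 2 * r ≤ 2 * D)] at hk1 hk2 ⊢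
    nlinarith [hk1, hk2]
  · have hk1 : 0 ≤ ((D : ℤ) - 1 - a) * ((D : ℤ) - 1 - a') := by
      apply mul_nonneg <;> omega
    have hk2 : 0 ≤ ((a : ℤ) + a' - D) * (2 * (D : ℤ) - 2 * r - 1 - (a + a')) := by
      apply mul_nonneg <;> omega
    zify [(by omega : a ≤ D), (by omega : a' ≤ D), (by omega : D ≤ a + a' + 2 * r), (by omega : 2 * r ≤ D),
      (by omega : 2 ≤ 4 * r), (by omega : a + a' ≤ 2 * D - 2 * r), (by omega : 2 * r ≤ 2 * D)] at hk1 hk2 ⊢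
    nlinarith [hk1, hk2]

/-- **THE COLUMN LOSS AT TWO BOUNDED ENDS, CORE:** for `1 ≤ r`, `2 r ≤ D`, `1 ≤ v, v' ≤ D`, `v + v' ≤ D + 2 r − 1` and
`R` with `(v + v' + R) mod D = 2 r mod D`: `φ_D(2 r) + (4 r − 2) ≤ v (D − v) + v' (D − v') + φ_D(R)`. -/
theorem column_loss_core (D r v v' R : ℕ) (hr : 1 ≤ r) (h2r : 2 * r ≤ D) (hv : 1 ≤ v) (hvD : v ≤ D) (hv' : 1 ≤ v')
    (hv'D : v' ≤ D) (hb : v + v' ≤ D + 2 * r - 1) (hR : (v + v' + R) % D = (2 * r) % D) :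
    phiD D (2 * r) + (4 * r - 2) ≤ v * (D - v) + v' * (D - v') + phiD D R := by
  have hD : 0 < D := by omega
  rw [phiD_two_mul_of_le D r h2r, phiD_mod D R]
  have hρ : R % D < D := Nat.mod_lt R hD
  have h2rm := mod_three_cases (2 * r) D (by omega)
  have hvv := mod_three_cases (v + v' + R % D) D (by omega)
  rw [Nat.add_mod_mod, hR] at hvv
  unfold phiD
  rw [Nat.mod_mod]
  rcases Nat.lt_or_ge v D with hvlt | hvge
  · rcases Nat.lt_or_ge v' D with hv'lt | hv'ge
    · rcases Nat.lt_or_ge (v + v') (2 * r + 1) with hs | hs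
      · have hρv : R % D = 2 * r - (v + v') := by omega
        rw [hρv]
        exact column_loss_low D r v v' h2r hv hv' (by omega)
      · have hρv : R % D = D + 2 * r - (v + v') := by omega
        rw [hρv]
        obtain ⟨a, ha⟩ : ∃ a, v = D - a := ⟨D - v, by omega⟩
        obtain ⟨a', ha'⟩ : ∃ a', v' = D - a' := ⟨D - v', by omega⟩
        have haD : a + 1 ≤ D := by omega
        have ha'D : a' + 1 ≤ D := by omega
        have ha1 : 1 ≤ a := by omega
        have ha1' : 1 ≤ a' := by omega
        subst ha ha'
        have e1 : D - (D - a) = a := by omega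
        have e2 : D - (D - a') = a' := by omega
        have e3 : D + 2 * r - (D - a + (D - a')) = a + a' + 2 * r - D := by omega
        have e4 : D - (a + a' + 2 * r - D) = 2 * D - 2 * r - (a + a') := by omega
        rw [e1, e2, e3, e4]
        exact column_loss_high D r a a' hr h2r ha1 haD ha1' ha'D (by omega) (by omega)
    · have hv'D' : v' = D := by omega
      have hρv : R % D = 2 * r - v := by omega
      rw [hv'D', hρv, Nat.sub_self, mul_zero, add_zero]
      exact column_loss_full D r v h2r hv (by omega)
  · have hvD' : v = D := by omega
    have hρv : R % D = 2 * r - v' := by omega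
    rw [hvD', hρv, Nat.sub_self, mul_zero, zero_add]
    exact column_loss_full D r v' h2r hv' (by omega)

/-- **THE COLUMN LOSS AT TWO BOUNDED ENDS:** values `c ≤ D` on `s` with `Σ c ≡ 2 r (mod D)`, two distinguished
members `x ≠ x'` with `1 ≤ c(x), c(x')` and `c(x) + c(x') ≤ D + 2 r − 1`: `φ_D(2 r) + (4 r − 2) ≤ Σ c (D − c)`. -/
theorem column_loss {ι : Type*} [DecidableEq ι] (s : Finset ι) (c : ι → ℕ) (D r : ℕ) (hr : 1 ≤ r)
    (h2r : 2 * r ≤ D) (hc : ∀ i ∈ s, c i ≤ D) (x x' : ι) (hx : x ∈ s) (hx' : x' ∈ s) (hne : x ≠ x')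
    (h1 : 1 ≤ c x) (h1' : 1 ≤ c x') (hb : c x + c x' ≤ D + 2 * r - 1)
    (hsum : (∑ i ∈ s, c i) % D = (2 * r) % D) :
    phiD D (2 * r) + (4 * r - 2) ≤ ∑ i ∈ s, c i * (D - c i) := by
  have hx'' : x' ∈ s.erase x := mem_erase.mpr ⟨hne.symm, hx'⟩
  rw [← sum_erase_add s _ hx, ← sum_erase_add (s.erase x) _ hx''] at hsum
  rw [← sum_erase_add s (fun i => c i * (D - c i)) hx, ← sum_erase_add (s.erase x) (fun i => c i * (D - c i)) hx'']
  have hrest := sum_mul_sub_ge_phi ((s.erase x).erase x') c D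
    (fun i hi => hc i (mem_of_mem_erase (mem_of_mem_erase hi)))
  have hcore := column_loss_core D r (c x) (c x') (∑ i ∈ (s.erase x).erase x', c i) hr h2r h1 (hc x hx) h1'
    (hc x' hx') hb (by rw [← hsum]; congr 1; ring)
  omega

end C047

end TriangleCap

end PercRepro
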